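import Literature.NumberTheory.NumberFields.CMFieldNormCokernelExponentTwo
import HarnessLib

/-!
# Okazaki's Lemma 24 with the sharp `2`-power: `h⁻_k ∣ 2^{r₁} h⁻_K` for every pair of CM fields `k ⊂ K`,
# via the CM field `K·H_{K⁺}` (Lemmas 21, 24, 25 of Okazaki, *Acta Arith.* 92 (2000), §4)

Topic `NumberTheory/NumberFields` (class field theory); namespace `Literature.NumberTheory.NumberFields`.
Theorem-only file (no definition, no named fact, no `sorry`), unconditional.  Sequel of
`CMFieldNormCokernelExponentTwo.lean`, whose Prop. 27 machinery gives, for CM fields `K ⊆ L` and a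
conjugation-stable subgroup `S ≤ Cl_K` containing `N_{L/K}(Cl_L)`: `c̄ · c⁻¹ ∈ S` for every class `c` of
`K` (`IsCMField.conj_smul_mul_inv_mem`: the class field of `S` embeds into the CM field `L`, so complex
conjugation acts trivially on `Cl_K/S`).  There the input CM field was `L` itself, which only yields
`S ⊇ N_{L/K}(Cl_L)` and Lemma 24 in the weak form `h⁻_K ∣ #A_K[4] · h⁻_L` (`A_F := ker(N : Cl_F → Cl_{F⁺})`).
Okazaki's proof of Lemma 24 uses instead the field `K H_{K⁺}` (his Lemma 21: «Let `H = K H_{K⁺} ∩ H_k` …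
`H` is a CM-field by Lemma 12»).  Here we construct, for a CM field `L`, **a CM number field `M ⊇ L`
into which the Hilbert class field `H_{L⁺}` of `L⁺` embeds over `L⁺`** (the compositum `L · H_{L⁺}`
inside `L̄`; CM as the compositum of the CM field `L` and the TOTALLY REAL field `H_{L⁺}` — the Hilbert
class field of a totally real field is totally real), and show **`N_{M/L}(Cl_M) ⊆ A_L`** (transitivity of
norms around `L⁺ ⊆ L ⊆ M`, `L⁺ ⊆ H_{L⁺} ⊆ M`, and `N_{H_{L⁺}/L⁺}(Cl_{H_{L⁺}}) = 1`).  Feeding `M` to the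
Prop. 27 machinery over `K` gives the KEY: **`c̄ · c⁻¹ ∈ N_{L/K}(A_L)` for every class `c` of `K`**, whence:

> Okazaki, §4, **Lemma 21.** "Let `k ⊂ K` be two CM-fields.  Then `[H_k : H_k⁰] ∣ h⁻_K`."  **Lemma 24.**
> "Let `k ⊂ K` be two CM-fields, and `r₁` the `2`-rank of `ker(N : C_k → C_{k⁺})`.  Then `h⁻_k ∣ 2^{r₁} h⁻_K`.
> *Proof.* … By definition of `C₁`, `σ` acts as inversion on `C₁/C₀`.  For these two descriptions of `σ`
> to agree, we must have `C₁/C₀ ≃ (ℤ/2ℤ)^{r₀}` with some integer `0 ≤ r₀ ≤ r₁`. …"  **Lemma 25.** "Let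
> `k ⊂ K` be two CM-fields and assume `h⁻_K = 1`.  Then the complex conjugation of `k` fixes `C_k`."

(`(K, L)` below are Okazaki's `(k, K)`.)  On `A_K` complex conjugation is inversion, so the KEY gives
`A_K² ⊆ N_{L/K}(A_L) ⊆ A_K`, hence **`#A_K ∣ #A_K[2] · #N_{L/K}(A_L)`**, i.e. Lemma 24 with Okazaki's exact
`2^{r₁} = #A_K[2]` (improving the tree's `#A_K[4]`); `h⁻_L = 1 ⟹ c̄ = c` on `Cl_K` (Lemma 25); and the class
field of `N_{L/K}(A_L)` — Okazaki's `H = KH_{K⁺} ∩ H_k`, of index `#N_{L/K}(A_L) ∣ h⁻_L` in `H_K` — is a CM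
field (the content of Lemma 21).

## Main results (`K L : Type` CM number fields, `L` a `K`-algebra; `A_F = (classGroupNorm F⁺ F).ker`)

* `hilbertClassField.isTotallyReal` — the Hilbert class field of a totally real field is totally real.
* `range_classGroupNorm_hilbertClassField_eq_bot` — `N_{H_F/F}(Cl_{H_F}) = 1`.
* **`IsCMField.exists_isCMField_range_classGroupNorm_le_ker`** — a CM number field `M ⊇ L` with
  `N_{M/L}(Cl_M) ⊆ A_L` (the compositum `L · H_{L⁺}`).
* **`IsCMField.conj_smul_mul_inv_mem_map_ker`** — KEY: `c̄ · c⁻¹ ∈ N_{L/K}(A_L)` for all `c ∈ Cl_K`.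
* `IsCMField.sq_mem_map_ker_classGroupNorm'` — `c ∈ A_K ⟹ c² ∈ N_{L/K}(A_L)`.
* **`IsCMField.card_ker_dvd_card_twoTorsion_mul_card_ker'`** — **Lemma 24: `h⁻_K ∣ #A_K[2] · h⁻_L`**
  (every pair of CM fields); `IsCMField.classNumber_div_dvd_card_twoTorsion_mul_classNumber_div'`.
* **`IsCMField.conj_smul_eq_self_of_card_ker_eq_one`** — **Lemma 25**: `h⁻_L = 1 ⟹ c̄ = c` on `Cl_K`;
  `IsCMField.conj_smul_eq_self_of_classNumber_eq`.
* **`IsCMField.isCMField_fixedField_galSubgroup_map_ker`** — Lemma 21's content: the class field of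
  `N_{L/K}(A_L)` is CM; `IsCMField.card_map_ker_dvd` — its index `#N_{L/K}(A_L)` in `H_K` divides `h⁻_L`.

Honest column: `H_k⁰` (the maximal CM subfield of `H_k`, Def. 19) is not introduced; Lemma 21 is rendered
by its use (the class field of `N_{L/K}(A_L)`, Okazaki's `H ⊆ H_k⁰`, is CM, of index dividing `h⁻_L`).
The field `M` is only asserted to exist with the two properties used (CM, `N_{M/L}(Cl_M) ⊆ A_L`); that it
is `L·H_{L⁺}` with `[M : L] = h_{L⁺}` and `M ⊆ H_L` is not recorded.  Props. 22–23 are not formalised.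

## References

* R. Okazaki, *Inclusion of CM-fields and divisibility of relative class numbers*, Acta Arith. 92 (2000)
  319–338, §2 Lemmas 6, 10–12, §4 Def. 19, Lemmas 20, 21, 24, 25 (held `paper:doi-10-4064-aa-92-4-319-338`,
  pp. 10–12). [Okazaki2000]
* G. Shimura, *Abelian Varieties with Complex Multiplication and Modular Functions* (1998), §18.2 Lemma
  (ii), (iv). [Shimura1998]
* J. Neukirch, *Algebraic Number Theory* (1999), Ch. III §1 Prop. (1.6) (i), Ch. VI §6 Prop. (6.9).
  [NeukirchANT1999]
* L. C. Washington, *Introduction to Cyclotomic Fields*, 2nd ed. (1997), Thm. 10.1. [Washington1997]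
-/

noncomputable section

open NumberField NumberField.IsCMField NumberField.InfinitePlace IsDedekindDomain Field
open scoped nonZeroDivisors

namespace Literature.NumberTheory.NumberFields

/-! ### §1. `H_F` is totally real for `F` totally real; `N_{H_F/F}(Cl_{H_F}) = 1` -/

section HilbertClassFieldFacts

variable (F : Type) [Field F] [NumberField F]

/-- **The Hilbert class field of a totally real field is totally real** (it is unramified at the
infinite places: every place above a real place is real). [cite: NeukirchANT1999, Ch. VI §6 Prop. (6.9)]
[cite: Okazaki2000, §2 Lemma 11 («an unramified extension of a totally real field …»)] -/
theorem hilbertClassField.isTotallyReal [IsTotallyReal F] : IsTotallyReal (hilbertClassField F) :=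
  ⟨fun W => hilbertClassField.isReal_of_isReal_comap F W (IsTotallyReal.isReal _)⟩

/-- **`N_{H_F/F}(Cl_{H_F}) = 1`: every norm from the Hilbert class field is principal** (the image of
the norm map corresponds under the Artin isomorphism to `Gal(H_F / H_F ∩ H_F) = 1`; tree
`index_range_classGroupNorm`). [cite: Washington1997, Thm. 10.1 (proof)] [cite: NeukirchANT1999, Ch. VI §6 Prop. (6.9)] -/
theorem range_classGroupNorm_hilbertClassField_eq_bot :
    (classGroupNorm F (hilbertClassField F)).range = ⊥ := by
  have hidx := index_range_classGroupNorm F (hilbertClassField F) (hilbertClassField F)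
  have htop : ((IsScalarTower.toAlgHom F (hilbertClassField F) (hilbertClassField F)).fieldRange).comap
      (IsScalarTower.toAlgHom F (hilbertClassField F) (hilbertClassField F)) = ⊤ := by
    rw [eq_top_iff]
    intro x _
    exact ⟨x, rfl⟩
  rw [htop, IntermediateField.finrank_top', hilbertClassField.finrank_eq_classNumber] at hidx
  have hcard := (classGroupNorm F (hilbertClassField F)).range.card_mul_index
  rw [hidx, classNumber, ← Nat.card_eq_fintype_card] at hcard
  have h1 : Nat.card (classGroupNorm F (hilbertClassField F)).range = 1 := by
    have hpos : 0 < Nat.card (ClassGroup (𝓞 F)) := Nat.card_pos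
    nlinarith [hcard, Nat.card_pos (α := (classGroupNorm F (hilbertClassField F)).range)]
  exact Subgroup.eq_bot_of_card_eq _ h1

end HilbertClassFieldFacts

/-! ### §2. The CM field `M = L · H_{L⁺}` with `N_{M/L}(Cl_M) ⊆ ker N_{L/L⁺}` -/

section Compositum

variable (L : Type) [Field L] [NumberField L] [IsCMField L]

/-- **The CM field `L·H_{L⁺}`**: for a CM field `L` there is a CM number field `M`, an `L`-algebra, with
**`N_{M/L}(Cl_M) ⊆ A_L = ker(N : Cl_L → Cl_{L⁺})`**.  Construction: inside `L̄` take the compositum `M` of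
`L` and of (an `L⁺`-embedded copy of) the Hilbert class field `H_{L⁺}`; it is CM as the compositum of a CM
field and a totally real field (Shimura 18.2 (ii); Okazaki's Lemmas 10–11), and
`N_{L/L⁺} ∘ N_{M/L} = N_{M/L⁺} = N_{H_{L⁺}/L⁺} ∘ N_{M/H_{L⁺}} = 1`.  (Okazaki: «`K H_{K⁺} ⊂ H_K`»,
«`h⁻_F = [H_F : F H_{F⁺}]` by class field theory».)
[cite: Okazaki2000, §4 (before Def. 19) and Lemma 21 (proof)] [cite: Shimura1998, §18.2 Lemma (ii)] -/
theorem IsCMField.exists_isCMField_range_classGroupNorm_le_ker :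
    ∃ (M : Type) (_ : Field M) (_ : NumberField M) (_ : IsCMField M) (_ : Algebra L M),
      (classGroupNorm L M).range ≤ (classGroupNorm (maximalRealSubfield L) L).ker := by
  classical
  -- the Hilbert class field of `L⁺`, embedded into `L̄` over `L⁺`
  haveI : Algebra.IsAlgebraic (maximalRealSubfield L) (hilbertClassField (maximalRealSubfield L)) :=
    Algebra.IsAlgebraic.of_finite _ _
  haveI : Algebra.IsAlgebraic (maximalRealSubfield L) (AlgebraicClosure L) :=
    Algebra.IsAlgebraic.trans (maximalRealSubfield L) L (AlgebraicClosure L)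
  let ψ : hilbertClassField (maximalRealSubfield L) →ₐ[maximalRealSubfield L] AlgebraicClosure L :=
    IsAlgClosed.lift
  -- the two subfields of `L̄` and their compositum
  let K₁ : IntermediateField ℚ (AlgebraicClosure L) := (IsScalarTower.toAlgHom ℚ L (AlgebraicClosure L)).fieldRange
  let K₂ : IntermediateField ℚ (AlgebraicClosure L) := (ψ.restrictScalars ℚ).fieldRange
  let eK₁ : L ≃ₐ[ℚ] K₁ := AlgEquiv.ofInjectiveField (IsScalarTower.toAlgHom ℚ L (AlgebraicClosure L))
  let eK₂ : hilbertClassField (maximalRealSubfield L) ≃ₐ[ℚ] K₂ := AlgEquiv.ofInjectiveField (ψ.restrictScalars ℚ)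
  haveI : FiniteDimensional ℚ K₁ := LinearEquiv.finiteDimensional eK₁.toLinearEquiv
  haveI : FiniteDimensional ℚ K₂ := LinearEquiv.finiteDimensional eK₂.toLinearEquiv
  haveI : NumberField K₁ := { to_charZero := inferInstance, to_finiteDimensional := inferInstance }
  haveI : NumberField K₂ := { to_charZero := inferInstance, to_finiteDimensional := inferInstance }
  set C : IntermediateField ℚ (AlgebraicClosure L) := K₁ ⊔ K₂ with hC
  haveI : FiniteDimensional ℚ C := IntermediateField.finiteDimensional_sup K₁ K₂
  haveI : NumberField C := { to_charZero := inferInstance, to_finiteDimensional := inferInstance }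
  haveI : IsTotallyReal (hilbertClassField (maximalRealSubfield L)) :=
    hilbertClassField.isTotallyReal (maximalRealSubfield L)
  have hCM : IsCMField C :=
    IntermediateField.isCMField_compositum_pair K₁ K₂ (isCMField_of_ringEquiv eK₁.symm.toRingEquiv inferInstance)
      (Or.inl (IsTotallyReal.ofRingEquiv eK₂.toRingEquiv))
  -- algebra structures `L → C`, `H_{L⁺} → C`, `L⁺ → C`
  let jL : L →+* C := (algebraMap L (AlgebraicClosure L)).codRestrict C fun x =>
    (le_sup_left : K₁ ≤ C) ⟨x, rfl⟩
  let jH : hilbertClassField (maximalRealSubfield L) →+* C := (ψ : _ →+* AlgebraicClosure L).codRestrict C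
    fun x => (le_sup_right : K₂ ≤ C) ⟨x, rfl⟩
  letI algL : Algebra L C := jL.toAlgebra
  letI algH : Algebra (hilbertClassField (maximalRealSubfield L)) C := jH.toAlgebra
  letI algP : Algebra (maximalRealSubfield L) C := (jL.comp (algebraMap (maximalRealSubfield L) L)).toAlgebra
  -- (towers stated through `Algebra.toSMul`, the form `classGroupNorm_classGroupNorm` elaborates to)
  haveI := IsScalarTower.of_algebraMap_eq (R := maximalRealSubfield L) (S := L) (A := C) fun _ => rfl
  haveI := IsScalarTower.of_algebraMap_eq (R := maximalRealSubfield L)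
    (S := hilbertClassField (maximalRealSubfield L)) (A := C) fun y => Subtype.ext (by
      change algebraMap L (AlgebraicClosure L) (algebraMap (maximalRealSubfield L) L y) =
        ψ (algebraMap (maximalRealSubfield L) (hilbertClassField (maximalRealSubfield L)) y)
      rw [ψ.commutes, IsScalarTower.algebraMap_apply (maximalRealSubfield L) L (AlgebraicClosure L)])
  refine ⟨C, inferInstance, inferInstance, hCM, algL, ?_⟩
  rintro _ ⟨d, rfl⟩
  rw [MonoidHom.mem_ker, classGroupNorm_classGroupNorm (maximalRealSubfield L) L C d,
    ← classGroupNorm_classGroupNorm (maximalRealSubfield L) (hilbertClassField (maximalRealSubfield L)) C d]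
  have h := range_classGroupNorm_hilbertClassField_eq_bot (maximalRealSubfield L)
  rw [Subgroup.eq_bot_iff_forall] at h
  exact h _ ⟨_, rfl⟩

end Compositum

/-! ### §3. KEY: `c̄ · c⁻¹ ∈ N_{L/K}(A_L)` for every class `c` of `K` -/

section Key

variable (K L : Type) [Field K] [NumberField K] [IsCMField K] [Field L] [NumberField L] [IsCMField L]
  [Algebra K L]

/-- `A_L = ker N_{L/L⁺}` is conjugation-stable (`ā = a⁻¹` there). [cite: Okazaki2000, §4 Lemma 24 (proof)] -/
theorem IsCMField.conj_smul_mem_ker {a : ClassGroup (𝓞 L)}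
    (ha : a ∈ (classGroupNorm (maximalRealSubfield L) L).ker) :
    ClassGroup.mulEquiv (AmbiguousClass.intAut (complexConj L)) a ∈
      (classGroupNorm (maximalRealSubfield L) L).ker := by
  rw [IsCMField.conj_smul_eq_inv_of_classGroupNorm_eq_one L ha]
  exact inv_mem ha

/-- **KEY (Okazaki's Lemma 21 with Lemma 6): `c̄ · c⁻¹ ∈ N_{L/K}(A_L)` for every class `c` of `K`**, CM fields
`K ⊆ L`: apply the Prop. 27 machinery (`IsCMField.conj_smul_mul_inv_mem`) to `K ⊆ M = L·H_{L⁺}` (a CM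
field) and `S = N_{L/K}(A_L)`, which contains `N_{M/K}(Cl_M) = N_{L/K}(N_{M/L} Cl_M) ⊆ N_{L/K}(A_L)` and is
conjugation-stable — Okazaki: «the action of `σ` on `Gal(H_k⁰/k)` is trivial and so is its action on
`C₁/C₀` by class field theory». [cite: Okazaki2000, §4 Lemmas 21, 24 (proofs)] -/
theorem IsCMField.conj_smul_mul_inv_mem_map_ker (c : ClassGroup (𝓞 K)) :
    ClassGroup.mulEquiv (AmbiguousClass.intAut (complexConj K)) c * c⁻¹ ∈
      ((classGroupNorm (maximalRealSubfield L) L).ker).map (classGroupNorm K L) := by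
  obtain ⟨M, _, _, _, _, hM⟩ := IsCMField.exists_isCMField_range_classGroupNorm_le_ker L
  letI : Algebra K M := ((algebraMap L M).comp (algebraMap K L)).toAlgebra
  haveI : IsScalarTower K L M := IsScalarTower.of_algebraMap_eq fun _ => rfl
  refine IsCMField.conj_smul_mul_inv_mem K M ?_ ?_ c
  · rintro _ ⟨d, rfl⟩
    exact ⟨classGroupNorm L M d, hM ⟨d, rfl⟩, classGroupNorm_classGroupNorm K L M d⟩
  · rintro _ ⟨a, ha, rfl⟩
    exact ⟨_, IsCMField.conj_smul_mem_ker L ha, IsCMField.classGroupNorm_conj_smul K L a⟩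

/-- **`c ∈ A_K ⟹ c² ∈ N_{L/K}(A_L)`** («`σ` acts as inversion on `C₁`»: `c̄ = c⁻¹`, so `c̄ c⁻¹ = c⁻²`).
[cite: Okazaki2000, §4 Lemma 24 (proof)] -/
theorem IsCMField.sq_mem_map_ker_classGroupNorm' {c : ClassGroup (𝓞 K)}
    (hc : c ∈ (classGroupNorm (maximalRealSubfield K) K).ker) :
    c ^ 2 ∈ ((classGroupNorm (maximalRealSubfield L) L).ker).map (classGroupNorm K L) := by
  have h := IsCMField.conj_smul_mul_inv_mem_map_ker K L c
  rw [IsCMField.conj_smul_eq_inv_of_classGroupNorm_eq_one K hc] at h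
  have h2 : c ^ 2 = (c⁻¹ * c⁻¹)⁻¹ := by group
  rw [h2]
  exact inv_mem h

end Key

/-! ### §4. Lemma 24 with `2^{r₁} = #A_K[2]`, and Lemma 25 -/

section LemmaTwentyFour

variable (K L : Type) [Field K] [NumberField K] [IsCMField K] [Field L] [NumberField L] [IsCMField L]
  [Algebra K L]

/-- **Okazaki's Lemma 24 for every pair of CM fields `K ⊆ L`: `#A_K ∣ #A_K[2] · #A_L`**, i.e.
`h⁻_K ∣ 2^{r₁} h⁻_L` with `2^{r₁} = #{c ∈ A_K : c² = 1}` (`r₁` = the `2`-rank of `A_K = ker(N : Cl_K → Cl_{K⁺})`):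
squaring maps `A_K` into `N_{L/K}(A_L)` (§3) with kernel `A_K[2]`.  (The tree's
`IsCMField.card_ker_dvd_card_twoTorsion_mul_card_ker` assumed `N_{L/K}` onto; `…fourTorsion…` had `#A_K[4]`.)
[cite: Okazaki2000, §4 Lemma 24] -/
theorem IsCMField.card_ker_dvd_card_twoTorsion_mul_card_ker' :
    Nat.card (classGroupNorm (maximalRealSubfield K) K).ker ∣
      Nat.card {c : (classGroupNorm (maximalRealSubfield K) K).ker // (c : ClassGroup (𝓞 K)) ^ 2 = 1} *
        Nat.card (classGroupNorm (maximalRealSubfield L) L).ker := by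
  classical
  set AK := (classGroupNorm (maximalRealSubfield K) K).ker with hAK
  set AL := (classGroupNorm (maximalRealSubfield L) L).ker with hAL
  set f : AK →* ClassGroup (𝓞 K) := (powMonoidHom 2).comp AK.subtype with hf
  have hrange : f.range ≤ AL.map (classGroupNorm K L) := by
    rintro _ ⟨c, rfl⟩
    exact IsCMField.sq_mem_map_ker_classGroupNorm' K L c.2
  have hker : Nat.card f.ker = Nat.card {c : AK // (c : ClassGroup (𝓞 K)) ^ 2 = 1} :=
    Nat.card_congr (Equiv.subtypeEquivRight fun c => by
      rw [MonoidHom.mem_ker, hf, MonoidHom.comp_apply, powMonoidHom_apply, Subgroup.subtype_apply])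
  have hcard : Nat.card f.ker * Nat.card f.range = Nat.card AK := by
    rw [← Subgroup.index_ker, Subgroup.card_mul_index]
  rw [← hcard, ← hker]
  exact Nat.mul_dvd_mul_left _
    ((Subgroup.card_dvd_of_le hrange).trans (Subgroup.card_map_dvd _ _))

/-- **Lemma 24 in class numbers: `h⁻_K ∣ #A_K[2] · h⁻_L`** (`h⁻_F = h_F/h_{F⁺}`), every pair of CM fields.
[cite: Okazaki2000, §4 Lemma 24] -/
theorem IsCMField.classNumber_div_dvd_card_twoTorsion_mul_classNumber_div' :
    classNumber K / classNumber (maximalRealSubfield K) ∣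
      Nat.card {c : (classGroupNorm (maximalRealSubfield K) K).ker // (c : ClassGroup (𝓞 K)) ^ 2 = 1} *
        (classNumber L / classNumber (maximalRealSubfield L)) := by
  rw [IsCMField.classNumber_div_eq_card_ker, IsCMField.classNumber_div_eq_card_ker]
  exact IsCMField.card_ker_dvd_card_twoTorsion_mul_card_ker' K L

/-- **`#A_K ∣ #A_K[2] · #N_{L/K}(A_L)`** — the form with Okazaki's `[H_k : H_k⁰] ∣ [H_k : H] = #N_{K/k}(A_K)`
visible. [cite: Okazaki2000, §4 Lemmas 21 and 24 (proofs)] -/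
theorem IsCMField.card_ker_dvd_card_twoTorsion_mul_card_map :
    Nat.card (classGroupNorm (maximalRealSubfield K) K).ker ∣
      Nat.card {c : (classGroupNorm (maximalRealSubfield K) K).ker // (c : ClassGroup (𝓞 K)) ^ 2 = 1} *
        Nat.card (((classGroupNorm (maximalRealSubfield L) L).ker).map (classGroupNorm K L)) := by
  classical
  set AK := (classGroupNorm (maximalRealSubfield K) K).ker with hAK
  set AL := (classGroupNorm (maximalRealSubfield L) L).ker with hAL
  set f : AK →* ClassGroup (𝓞 K) := (powMonoidHom 2).comp AK.subtype with hf
  have hrange : f.range ≤ AL.map (classGroupNorm K L) := by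
    rintro _ ⟨c, rfl⟩
    exact IsCMField.sq_mem_map_ker_classGroupNorm' K L c.2
  have hker : Nat.card f.ker = Nat.card {c : AK // (c : ClassGroup (𝓞 K)) ^ 2 = 1} :=
    Nat.card_congr (Equiv.subtypeEquivRight fun c => by
      rw [MonoidHom.mem_ker, hf, MonoidHom.comp_apply, powMonoidHom_apply, Subgroup.subtype_apply])
  have hcard : Nat.card f.ker * Nat.card f.range = Nat.card AK := by
    rw [← Subgroup.index_ker, Subgroup.card_mul_index]
  rw [← hcard, ← hker]
  exact Nat.mul_dvd_mul_left _ (Subgroup.card_dvd_of_le hrange)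

/-- **Okazaki's Lemma 25: if `h⁻_L = 1` then complex conjugation fixes every ideal class of `K`** (CM fields
`K ⊆ L`): `c̄ · c⁻¹ ∈ N_{L/K}(A_L) = N_{L/K}(1) = 1`. [cite: Okazaki2000, §4 Lemma 25] -/
theorem IsCMField.conj_smul_eq_self_of_card_ker_eq_one
    (h : Nat.card (classGroupNorm (maximalRealSubfield L) L).ker = 1) (c : ClassGroup (𝓞 K)) :
    ClassGroup.mulEquiv (AmbiguousClass.intAut (complexConj K)) c = c := by
  have hbot : (classGroupNorm (maximalRealSubfield L) L).ker = ⊥ := Subgroup.eq_bot_of_card_eq _ h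
  have hmem := IsCMField.conj_smul_mul_inv_mem_map_ker K L c
  rw [hbot, Subgroup.map_bot, Subgroup.mem_bot] at hmem
  exact mul_inv_eq_one.mp hmem

/-- Lemma 25 in class numbers: **`h_L = h_{L⁺}` (i.e. `h⁻_L = 1`) ⟹ `c̄ = c` for every class `c` of `K`.**
[cite: Okazaki2000, §4 Lemma 25] -/
theorem IsCMField.conj_smul_eq_self_of_classNumber_eq
    (h : classNumber L = classNumber (maximalRealSubfield L)) (c : ClassGroup (𝓞 K)) :
    ClassGroup.mulEquiv (AmbiguousClass.intAut (complexConj K)) c = c := by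
  apply IsCMField.conj_smul_eq_self_of_card_ker_eq_one K L _ c
  have hpos : 0 < classNumber (maximalRealSubfield L) := by unfold classNumber; exact Fintype.card_pos
  rw [← IsCMField.classNumber_div_eq_card_ker, h, Nat.div_self hpos]

end LemmaTwentyFour

/-! ### §5. Lemma 21: the class field of `N_{L/K}(A_L)` is a CM field, of index `#N_{L/K}(A_L) ∣ h⁻_L` in `H_K` -/

section LemmaTwentyOne

variable (K L : Type) [Field K] [NumberField K] [IsCMField K] [Field L] [NumberField L] [IsCMField L]
  [Algebra K L]

open hilbertClassField in
/-- **Okazaki's Lemma 21 (content): the class field of `N_{L/K}(A_L) ≤ Cl_K` — his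
`H = K H_{K⁺} ∩ H_k ⊆ H_k` — is a CM field** (it embeds into the CM field `M = L·H_{L⁺}` by norm
limitation, since `N_{M/K}(Cl_M) ⊆ N_{L/K}(A_L)`; «`H` is a CM-field by Lemma 12 … it follows that
`H ⊂ H_k⁰`»). [cite: Okazaki2000, §4 Lemma 21] -/
theorem IsCMField.isCMField_fixedField_galSubgroup_map_ker :
    IsCMField (IntermediateField.fixedField
      (galSubgroup K (((classGroupNorm (maximalRealSubfield L) L).ker).map (classGroupNorm K L)))) := by
  obtain ⟨M, _, _, _, _, hM⟩ := IsCMField.exists_isCMField_range_classGroupNorm_le_ker L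
  letI : Algebra K M := ((algebraMap L M).comp (algebraMap K L)).toAlgebra
  haveI : IsScalarTower K L M := IsScalarTower.of_algebraMap_eq fun _ => rfl
  refine IsCMField.isCMField_fixedField_galSubgroup K M _ ?_
  rintro _ ⟨d, rfl⟩
  exact ⟨classGroupNorm L M d, hM ⟨d, rfl⟩, classGroupNorm_classGroupNorm K L M d⟩

omit [IsCMField K] in
/-- **`[H_K : H] = #N_{L/K}(A_L)` divides `h⁻_L`** for Okazaki's `H` (the class field of `N_{L/K}(A_L)`; in
the tree `[H_K : F_S] = #S` for the class field `F_S` of `S`): `#N_{L/K}(A_L) ∣ #A_L = h⁻_L`.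
[cite: Okazaki2000, §4 Lemma 21] -/
theorem IsCMField.card_map_ker_dvd :
    Nat.card (((classGroupNorm (maximalRealSubfield L) L).ker).map (classGroupNorm K L)) ∣
      classNumber L / classNumber (maximalRealSubfield L) := by
  rw [IsCMField.classNumber_div_eq_card_ker]
  exact Subgroup.card_map_dvd _ _

end LemmaTwentyOne

end Literature.NumberTheory.NumberFields

end
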